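import Summits.ABC.IUTFork.LanaLogLinkLiftingBad
import Summits.ABC.IUTFork.LanaLogLinkLiftingHolds
import Literature.AnabelianGeometry.SemiGraphs.TemperedCurveDeltaCharacteristic
import Literature.AnabelianGeometry.SemiGraphs.TemperedCurveDeltaCharacteristicHat
import HarnessLib

/-!
# L-LANA objects IX novies: existence of the bad-place lifting with (H1) REPLACED by the
# [AbsTopI] Thm 2.6 (v) regime on a completion package

Record-only, proof-only sequel (D-0012; seat abc-iut-w6-d027 gen 3, row «BAD-H1-PACKAGE»; L-LANA level,
plan/LLANA-SPEC N12) of `LanaLogLinkLiftingBad.lean` (p437440); TAKES NO SIDE on [IUTchIII] Cor. 3.12.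
There, LANA §5.3 (a) p. 29 ("any isomorphism of `D`-prime strips can be uniquely lifted to an isomorphism
of `F`-prime strips", [IUTchI] Cor. 5.3 (ii)) at a BAD place `v` (`Π_v = Π^temp_{X_K}` tempered, datum
`X : TemperedCurve p`) was proved with uniqueness UNCONDITIONAL (`bad_liftUnique`) and existence from
«`Π^temp_{X_K}` tempered + Galois-countable», the continuity clause `hcont` (LANA Def. 3.7.1) and the
anabelian input (H1) «`Δ^temp_X ⊆ Π^temp_{X_K}` is characteristic under topological automorphisms»
(`bad_liftExists_of_char_of_cont`).  abc-iut-L3/L4's `TemperedCurveDeltaCharacteristic.lean` reduces (H1)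
for EVERY curve-level datum `X` along the profinite completion `Π^temp_{X_K} ↪ Π_{X_K}` ([SemiAnbd] §6
p. 69) to the PROFINITE statement of [AbsTopI] Thm 2.6 (v) p. 22 ("the kernel of the quotient `Π ↠ G`
may be characterized group-theoretically"), i.e. to ONE Thm 2.6 regime on a compatible completion package
— the package itself existing hypothesis-free (`TemperedCurve.exists_completion_package`).  THIS file plugs
that in, so that bad places stand at parity with the [IUTchII] §1 settings of abc-iut-w5-d233's
`ThetaSettingDeltaCharacteristicGenuine.lean` (p429527):

* `bad_liftExists_of_deltaHat_of_cont` — existence at a bad-place datum from «`Δ_X ⊆ Π_{X_K}` characteristic»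
  for the curve's OWN profinite completion (interface `DeltaHat`) + `hcont`;
* `bad_liftExists_of_package_of_cont` / `bad_liftExists_of_regime_of_cont` — existence from ONE compatible
  completion package `(E, B, ι, g)` with `Δ_E` topologically finitely generated and `CoinvariantRankConstant`
  (FACT-LIST F-0001 BY NAME at the instance `E`), resp. from the regime quantified over packages, + `hcont`;
* `bad_liftExists_of_groupLevelData_of_package` — the same over L3's parameter bundle `X.GroupLevelData`;
* `bad_uniqueLifting_of_package_of_cont` / `bad_uniqueLifting_of_deltaHat_of_cont` — `UniqueLifting` for a
  family of bad-place data, (H1) replaced as above;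
* `good_liftExists_of_coinvariantRankConstant_of_cont` / `good_uniqueLifting_of_coinvariantRankConstant_of_cont`
  — the GOOD-place twin (`Π_v = Π_E` profinite, `LanaLogLinkLiftingHolds` §Good): there (H1) IS the profinite
  statement, so it is replaced by the Thm 2.6 (v) regime on `E` itself (MLF base data `(p, ℚ_p, e)` read off
  the datum's `e : G_v ⥲ G_{ℚ_p}`, or any `B : E.MLFBase`).

HONEST SCOPE. (i) `hcont` (LANA Def. 3.7.1) is NOT discharged.  (ii) What replaces (H1) is print's input at
this point: [AbsTopI] Prop 2.2 (`Δ` topologically finitely generated) and the rank computation of [AbsAnab]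
Lemma 1.1.4 (ii) (`CoinvariantRankConstant`, F-0001) for the profinite `Π_{X_K}` — a regime hypothesis on
the package, which the abstract interface `TemperedCurve p` does not carry.  (iii) Nothing here says that
`X` IS the `π₁^temp` of the curve `X_v` of the initial Θ-data.  [cite: LANA2026Report, §5.3 (a) p. 29]
[cite: MochizukiAbsTopI2012, Thm 2.6 (v) p.22] [cite: MochizukiSemiAnbd2006, §6 p.69]
NOT here: any judgement.
-/

noncomputable section

namespace Summit.ABC
namespace IUTFork

open Literature.AnabelianGeometry.AbsoluteAnabelian
open Literature.AnabelianGeometry.SemiGraphs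
open Literature.AnabelianGeometry.EtaleTheta (IsTopCharacteristic)

variable {p : ℕ} [Fact p.Prime]

/-! ## 0. Good places: (H1) IS the profinite statement — the Thm 2.6 (v) regime on `E` itself -/

section Good

variable (p)
variable (E : FundamentalExtension.{0}) (e : E.gal ≃ₜ* PadicGal p)

/-- **Existence half at a good-place datum from the [AbsTopI] Thm 2.6 (v) regime on `E` + the continuity
clause**: for ANY MLF base data `B` of `E`, `Δ_E` topologically finitely generated and `CoinvariantRankConstant`
(FACT-LIST F-0001 BY NAME at the instance `E`) give «`Δ_E ⊆ Π_E` characteristic»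
(`FundamentalExtension.preservesGeom_of_coinvariantRankConstant`), whence `good_liftExists_of_char_of_cont`.
[cite: MochizukiAbsTopI2012, Thm 2.6 (v) p.22] [cite: LANA2026Report, §5.3 (a) p. 29] -/
theorem good_liftExists_of_mlfBase_of_coinvariantRankConstant_of_cont (B : E.MLFBase)
    (hΔ : IsTopologicallyFinitelyGenerated E.geom) (hc : E.CoinvariantRankConstant)
    (hcont : ∀ f : GaloisMonoidPair.Iso (goodPair p E e) (goodPair p E e), Continuous f.isoM ∧ Continuous f.isoM.symm) :
    (RefLocalDatum.ofExtension p E e).LiftExists :=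
  good_liftExists_of_char_of_cont p E e
    (fun φ => FundamentalExtension.preservesGeom_of_coinvariantRankConstant B B hΔ hc hΔ hc φ) hcont

/-- **Existence half at a good-place datum from the Thm 2.6 (v) regime on `E` + the continuity clause**, the
MLF base data being READ OFF the datum: `G_v ⥲ G_{ℚ_p} = Gal(ℚ̄_p/ℚ_p)` (`e`), base field `ℚ_p`.
[cite: MochizukiAbsTopI2012, Thm 2.6 (v) p.22] [cite: LANA2026Report, §5.3 (a) p. 29] -/
theorem good_liftExists_of_coinvariantRankConstant_of_cont
    (hΔ : IsTopologicallyFinitelyGenerated E.geom) (hc : E.CoinvariantRankConstant)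
    (hcont : ∀ f : GaloisMonoidPair.Iso (goodPair p E e) (goodPair p E e), Continuous f.isoM ∧ Continuous f.isoM.symm) :
    (RefLocalDatum.ofExtension p E e).LiftExists :=
  good_liftExists_of_mlfBase_of_coinvariantRankConstant_of_cont p E e
    { p := p, K := ℚ_[p], galIso := e } hΔ hc hcont

/-- **`UniqueLifting` for a family of GOOD-place data with (H1) replaced by the Thm 2.6 (v) regime at every
place** (+ the continuity clause; uniqueness unconditional, `good_liftUnique`).
[cite: LANA2026Report, §5.3 (a) p. 29] [cite: MochizukiAbsTopI2012, Thm 2.6 (v) p.22] -/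
theorem good_uniqueLifting_of_coinvariantRankConstant_of_cont {V : Type} (Ev : V → FundamentalExtension.{0})
    (ev : ∀ v, (Ev v).gal ≃ₜ* PadicGal p)
    (hΔ : ∀ v, IsTopologicallyFinitelyGenerated (Ev v).geom) (hc : ∀ v, (Ev v).CoinvariantRankConstant)
    (hcont : ∀ v (f : GaloisMonoidPair.Iso (goodPair p (Ev v) (ev v)) (goodPair p (Ev v) (ev v))),
      Continuous f.isoM ∧ Continuous f.isoM.symm) :
    UniqueLifting (fun v => RefLocalDatum.ofExtension p (Ev v) (ev v)) :=
  uniqueLifting_of_ref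
    (fun v => good_liftExists_of_coinvariantRankConstant_of_cont p (Ev v) (ev v) (hΔ v) (hc v) (hcont v))
    (fun v => good_liftUnique p (Ev v) (ev v))

end Good

namespace TemperedCurveRef

variable (X : TemperedCurve p)

/-! ## 1. Existence at one bad-place datum -/

/-- **Existence half at a bad-place datum from «`Δ_X ⊆ Π_{X_K}` is characteristic» (PROFINITE form) + the
continuity clause**: the tempered (H1) follows along the curve's own profinite completion
`Π^temp_{X_K} ↪ Π_{X_K}` (`TemperedCurve.isTopCharacteristic_deltaTemp_of_deltaHat`).
[cite: MochizukiAbsTopI2012, Thm 2.6 (v) p.22] [cite: LANA2026Report, §5.3 (a) p. 29] -/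
theorem bad_liftExists_of_deltaHat_of_cont [FirstCountableTopology X.PiTemp] (hX : IsTempered X.PiTemp)
    (hchar : IsTopCharacteristic X.PiHat X.DeltaHat)
    (hcont : ∀ f : GaloisMonoidPair.Iso (badPair X) (badPair X), Continuous f.isoM ∧ Continuous f.isoM.symm) :
    (RefLocalDatum.ofTemperedCurve X).LiftExists :=
  bad_liftExists_of_char_of_cont X hX (X.isTopCharacteristic_deltaTemp_of_deltaHat hchar) hcont

/-- **Existence half at a bad-place datum from ONE compatible completion package in the [AbsTopI]
Thm 2.6 (v) regime + the continuity clause**: a profinite completion `ι : Π^temp_{X_K} → Π_E` into an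
extension with MLF base data `B`, augmentations compatible through an injective `g : G_K → G_E`, `Δ_E`
topologically finitely generated and `CoinvariantRankConstant` (FACT-LIST F-0001 BY NAME at `E`) — the
package half is inhabited for every `X` by `TemperedCurve.exists_completion_package`.
[cite: MochizukiAbsTopI2012, Thm 2.6 (v) p.22] [cite: LANA2026Report, §5.3 (a) p. 29] -/
theorem bad_liftExists_of_package_of_cont [FirstCountableTopology X.PiTemp] (hX : IsTempered X.PiTemp)
    (hpkg : ∃ (E : FundamentalExtension.{0}) (_ : E.MLFBase) (ι : X.PiTemp →ₜ* E.arith)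
      (g : X.GK →* E.gal), IsProfiniteCompletion ι ∧ Function.Injective g ∧
        (∀ x, E.aug (ι x) = g (X.augGK x)) ∧
        IsTopologicallyFinitelyGenerated E.geom ∧ E.CoinvariantRankConstant)
    (hcont : ∀ f : GaloisMonoidPair.Iso (badPair X) (badPair X), Continuous f.isoM ∧ Continuous f.isoM.symm) :
    (RefLocalDatum.ofTemperedCurve X).LiftExists :=
  bad_liftExists_of_char_of_cont X hX (X.isTopCharacteristic_deltaTemp_of_exists_package hpkg) hcont

/-- **Existence half at a bad-place datum modulo ONE [AbsTopI] Thm 2.6 (v) regime hypothesis** quantified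
over compatible completion packages with MLF base data (the only named anabelian input left: `Δ_E`
topologically finitely generated + `CoinvariantRankConstant`, F-0001 at the instance), + the continuity
clause. [cite: MochizukiAbsTopI2012, Thm 2.6 (v) p.22] [cite: LANA2026Report, §5.3 (a) p. 29] -/
theorem bad_liftExists_of_regime_of_cont [FirstCountableTopology X.PiTemp] (hX : IsTempered X.PiTemp)
    (hreg : ∀ (E : FundamentalExtension.{0}) (_ : E.MLFBase) (ι : X.PiTemp →ₜ* E.arith)
      (g : X.GK →* E.gal), IsProfiniteCompletion ι → Function.Injective g →
        (∀ x, E.aug (ι x) = g (X.augGK x)) →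
        IsTopologicallyFinitelyGenerated E.geom ∧ E.CoinvariantRankConstant)
    (hcont : ∀ f : GaloisMonoidPair.Iso (badPair X) (badPair X), Continuous f.isoM ∧ Continuous f.isoM.symm) :
    (RefLocalDatum.ofTemperedCurve X).LiftExists :=
  bad_liftExists_of_char_of_cont X hX (X.isTopCharacteristic_deltaTemp_of_regime hreg) hcont

/-- **Existence half from L3's parameter bundle** `d : X.GroupLevelData` ("`Π^temp` tempered",
"Galois-countable", ruling η′) + ONE completion package in the Thm 2.6 (v) regime + the continuity clause.
[cite: MochizukiSemiAnbd2006, Ex 3.10 pp.43-45] [cite: MochizukiAbsTopI2012, Thm 2.6 (v) p.22]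
[cite: LANA2026Report, §5.3 (a) p. 29] -/
theorem bad_liftExists_of_groupLevelData_of_package (d : X.GroupLevelData)
    (hpkg : ∃ (E : FundamentalExtension.{0}) (_ : E.MLFBase) (ι : X.PiTemp →ₜ* E.arith)
      (g : X.GK →* E.gal), IsProfiniteCompletion ι ∧ Function.Injective g ∧
        (∀ x, E.aug (ι x) = g (X.augGK x)) ∧
        IsTopologicallyFinitelyGenerated E.geom ∧ E.CoinvariantRankConstant)
    (hcont : ∀ f : GaloisMonoidPair.Iso (badPair X) (badPair X), Continuous f.isoM ∧ Continuous f.isoM.symm) :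
    (RefLocalDatum.ofTemperedCurve X).LiftExists :=
  bad_liftExists_of_groupLevelData X d (X.isTopCharacteristic_deltaTemp_of_exists_package hpkg) hcont

/-- **Existence half from L3's parameter bundle + «`Δ_X ⊆ Π_{X_K}` characteristic» (profinite form) + the
continuity clause.** [cite: MochizukiSemiAnbd2006, Ex 3.10 pp.43-45] [cite: MochizukiAbsTopI2012, Thm 2.6 (v) p.22]
[cite: LANA2026Report, §5.3 (a) p. 29] -/
theorem bad_liftExists_of_groupLevelData_of_deltaHat (d : X.GroupLevelData)
    (hchar : IsTopCharacteristic X.PiHat X.DeltaHat)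
    (hcont : ∀ f : GaloisMonoidPair.Iso (badPair X) (badPair X), Continuous f.isoM ∧ Continuous f.isoM.symm) :
    (RefLocalDatum.ofTemperedCurve X).LiftExists :=
  bad_liftExists_of_groupLevelData X d (X.isTopCharacteristic_deltaTemp_of_deltaHat hchar) hcont

/-! ## 2. `UniqueLifting` for a family of bad-place data -/

/-- **`UniqueLifting` for a family of BAD-PLACE data with (H1) REPLACED by one completion package per place
in the [AbsTopI] Thm 2.6 (v) regime** (+ L3's parameter bundles + the continuity clause; uniqueness is
unconditional, `bad_liftUnique`). [cite: LANA2026Report, §5.3 (a) p. 29]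
[cite: MochizukiAbsTopI2012, Thm 2.6 (v) p.22] -/
theorem bad_uniqueLifting_of_package_of_cont {V : Type} (Xv : V → TemperedCurve p)
    (d : ∀ v, (Xv v).GroupLevelData)
    (hpkg : ∀ v, ∃ (E : FundamentalExtension.{0}) (_ : E.MLFBase) (ι : (Xv v).PiTemp →ₜ* E.arith)
      (g : (Xv v).GK →* E.gal), IsProfiniteCompletion ι ∧ Function.Injective g ∧
        (∀ x, E.aug (ι x) = g ((Xv v).augGK x)) ∧
        IsTopologicallyFinitelyGenerated E.geom ∧ E.CoinvariantRankConstant)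
    (hcont : ∀ v (f : GaloisMonoidPair.Iso (badPair (Xv v)) (badPair (Xv v))),
      Continuous f.isoM ∧ Continuous f.isoM.symm) :
    UniqueLifting (fun v => RefLocalDatum.ofTemperedCurve (Xv v)) :=
  bad_uniqueLifting_of_char_of_cont Xv d
    (fun v => (Xv v).isTopCharacteristic_deltaTemp_of_exists_package (hpkg v)) hcont

/-- **`UniqueLifting` for a family of BAD-PLACE data from «`Δ_X ⊆ Π_{X_K}` characteristic» (profinite form)
at every place** (+ L3's parameter bundles + the continuity clause). [cite: LANA2026Report, §5.3 (a) p. 29]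
[cite: MochizukiAbsTopI2012, Thm 2.6 (v) p.22] -/
theorem bad_uniqueLifting_of_deltaHat_of_cont {V : Type} (Xv : V → TemperedCurve p)
    (d : ∀ v, (Xv v).GroupLevelData) (hchar : ∀ v, IsTopCharacteristic (Xv v).PiHat (Xv v).DeltaHat)
    (hcont : ∀ v (f : GaloisMonoidPair.Iso (badPair (Xv v)) (badPair (Xv v))),
      Continuous f.isoM ∧ Continuous f.isoM.symm) :
    UniqueLifting (fun v => RefLocalDatum.ofTemperedCurve (Xv v)) :=
  bad_uniqueLifting_of_char_of_cont Xv d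
    (fun v => (Xv v).isTopCharacteristic_deltaTemp_of_deltaHat (hchar v)) hcont

/-- **The log-link over a family of bad-place data EXISTS AND IS UNIQUE over its étale isomorphism** as soon as
each place carries L3's parameter bundle, one completion package in the Thm 2.6 (v) regime and the continuity
clause: the `UniqueLifting` input of `LanaLogLinkLifting` is then a theorem, uniqueness being unconditional
(`logLink_lift_unique_bad`). [cite: LANA2026Report, §5.3 (a) p. 29] [cite: MochizukiAbsTopI2012, Thm 2.6 (v) p.22] -/
theorem bad_liftExists_family_of_package_of_cont {V : Type} (Xv : V → TemperedCurve p)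
    (d : ∀ v, (Xv v).GroupLevelData)
    (hpkg : ∀ v, ∃ (E : FundamentalExtension.{0}) (_ : E.MLFBase) (ι : (Xv v).PiTemp →ₜ* E.arith)
      (g : (Xv v).GK →* E.gal), IsProfiniteCompletion ι ∧ Function.Injective g ∧
        (∀ x, E.aug (ι x) = g ((Xv v).augGK x)) ∧
        IsTopologicallyFinitelyGenerated E.geom ∧ E.CoinvariantRankConstant)
    (hcont : ∀ v (f : GaloisMonoidPair.Iso (badPair (Xv v)) (badPair (Xv v))),
      Continuous f.isoM ∧ Continuous f.isoM.symm) (v : V) :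
    (RefLocalDatum.ofTemperedCurve (Xv v)).LiftExists :=
  bad_liftExists_of_groupLevelData_of_package (Xv v) (d v) (hpkg v) (hcont v)

/-! ## 3. Bad places: (H1) from [AbsTopI] Prop 2.2 + the rank constancy on the curve's OWN `Π_{X_K}`

Appended by abc-iut-w6-d027 gen 3 (row «BAD-H1-PACKAGE», sequel `TemperedCurveDeltaCharacteristicHat.lean`): under
L3's parameter bundle the completed sequence `1 → Δ_X → Π_{X_K} → G_K → 1` of the interface is exact
(`TemperedCurve.ker_augHat_eq_deltaHat`), so the Thm 2.6 (v) regime may be stated on the curve's own profinite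
groups — `Δ_X` topologically finitely generated ([AbsTopI] Prop 2.2) and `δ¹_l(Π′) − δ¹_l(augHat Π′)` independent
of `l` for open `Π′ ≤ Π_{X_K}` (FACT-LIST F-0001 spelled out at the instance) — with no auxiliary package. -/

/-- **Existence half at a bad-place datum from print's inputs on the curve's OWN `Π_{X_K}`**: L3's parameter
bundle `d`, `Δ_X` topologically finitely generated ([AbsTopI] Prop 2.2), the [AbsAnab] Lemma 1.1.4 (ii) rank
constancy for `augHat : Π_{X_K} → G_K` on open subgroups (F-0001 at the instance, spelled out), and the continuity
clause. [cite: MochizukiAbsTopI2012, Thm 2.6 (v) p.22] [cite: LANA2026Report, §5.3 (a) p. 29]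
[cite: MochizukiSemiAnbd2006, §6 p.69] -/
theorem bad_liftExists_of_groupLevelData_of_hat_regime (d : X.GroupLevelData)
    (hΔ : IsTopologicallyFinitelyGenerated X.DeltaHat)
    (hc : ∀ P : Subgroup X.PiHat, IsOpen (P : Set X.PiHat) →
      ∀ (l₁ l₂ : ℕ) [Fact l₁.Prime] [Fact l₂.Prime],
        freeProlRank P l₁ - freeProlRank (P.map X.augHat.toMonoidHom) l₁ =
          freeProlRank P l₂ - freeProlRank (P.map X.augHat.toMonoidHom) l₂)
    (hcont : ∀ f : GaloisMonoidPair.Iso (badPair X) (badPair X), Continuous f.isoM ∧ Continuous f.isoM.symm) :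
    (RefLocalDatum.ofTemperedCurve X).LiftExists :=
  bad_liftExists_of_groupLevelData X d
    (X.isTopCharacteristic_deltaTemp_of_groupLevelData_of_hat_regime d hΔ hc) hcont

/-- **`UniqueLifting` for a family of BAD-PLACE data from print's inputs on each curve's own `Π_{X_K}`** (parameter
bundles, `Δ_X` tfg, rank constancy for `augHat`, continuity clause; uniqueness unconditional).
[cite: LANA2026Report, §5.3 (a) p. 29] [cite: MochizukiAbsTopI2012, Thm 2.6 (v) p.22] -/
theorem bad_uniqueLifting_of_hat_regime_of_cont {V : Type} (Xv : V → TemperedCurve p)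
    (d : ∀ v, (Xv v).GroupLevelData) (hΔ : ∀ v, IsTopologicallyFinitelyGenerated (Xv v).DeltaHat)
    (hc : ∀ v (P : Subgroup (Xv v).PiHat), IsOpen (P : Set (Xv v).PiHat) →
      ∀ (l₁ l₂ : ℕ) [Fact l₁.Prime] [Fact l₂.Prime],
        freeProlRank P l₁ - freeProlRank (P.map (Xv v).augHat.toMonoidHom) l₁ =
          freeProlRank P l₂ - freeProlRank (P.map (Xv v).augHat.toMonoidHom) l₂)
    (hcont : ∀ v (f : GaloisMonoidPair.Iso (badPair (Xv v)) (badPair (Xv v))),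
      Continuous f.isoM ∧ Continuous f.isoM.symm) :
    UniqueLifting (fun v => RefLocalDatum.ofTemperedCurve (Xv v)) :=
  bad_uniqueLifting_of_char_of_cont Xv d
    (fun v => (Xv v).isTopCharacteristic_deltaTemp_of_groupLevelData_of_hat_regime (d v) (hΔ v) (hc v))
    hcont

end TemperedCurveRef

end IUTFork

end Summit.ABC

end
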